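import Literature.Probability.Distributions.GaussianSphereMarginalTV
import Literature.Probability.Distributions.GaussianSphereMarginalIndep
import Literature.MeasureTheory.TotalVariation.SetwiseLimit
import HarnessLib

/-!
# The Maxwell–Borel lemma in testing form (equivalence of ensembles for the ideal gas)

`Literature/Probability/Distributions/`. Let `x ∼ γ_{E₁}`, `z ∼ γ_F` be independent standard
Gaussian vectors (`k = dim E₁`, `m = dim F ≥ 3`, `d = k + m`) and `Q = ‖x‖² + ‖z‖²`. Conditionally on
`Q`, the vector `(x, z)` is uniform on the sphere of radius `√Q`, so the conditional law of `x`
given `Q` is close (Diaconis–Freedman, sibling `GaussianSphereMarginalTV`) to the centred Gaussian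
of variance `Q/d` per coordinate. In testing form, for every measurable `|g| ≤ 1` on `E₁` and
every bounded measurable weight `ψ(Q) ≥ 0`:

* `abs_integral_sub_gaussianAverage_mul_le` —
  `|E[(g(x) − ∫ g(√(Q/d) u) dγ_{E₁}(u)) ψ(Q)]| ≤ 2 C_k/d · E[ψ(Q)]`, `C_k = k(k+2) + 32·2ᵏ`.

Proof: `x = √Q · b` with `b = x/√Q` independent of `Q` (`map_sphereMarginalMap_normSq_eq_prod`);
Fubini over the product law, and at fixed `Q = q` the two averages of `y ↦ g(√(q/d) y)` under
`Law(√d b)` and `γ_{E₁}` differ by at most twice their setwise distance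
(`tvClose_sphereMarginal_stdGaussian`, `TVClose.abs_integral_sub_le`). Sources: É. Borel (1906);
P. Diaconis, D. Freedman, Ann. IHP B 23 (1987) 397–423, Thm. 1 and §6.
-/

noncomputable section

open MeasureTheory ProbabilityTheory Set Real Metric Module
open scoped ENNReal

/-- **Test functions bounded by one.** If `μ, ν` are `ε`-close on sets then
`|∫ g dμ − ∫ g dν| ≤ 2ε` for every measurable `|g| ≤ 1` (apply `TVClose.abs_integral_sub_le` to
`(g + 1)/2 ∈ [0, 1]`). [folklore] -/
theorem Literature.MeasureTheory.TotalVariation.TVClose.abs_integral_sub_le_two_mul {α : Type*}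
    [MeasurableSpace α] {μ ν : Measure α} [IsProbabilityMeasure μ] [IsProbabilityMeasure ν] {ε : ℝ}
    (h : Literature.MeasureTheory.TotalVariation.TVClose μ ν ε) {g : α → ℝ} (hg : Measurable g)
    (h1 : ∀ x, |g x| ≤ 1) : |∫ x, g x ∂μ - ∫ x, g x ∂ν| ≤ 2 * ε := by
  have key := h.abs_integral_sub_le (g := fun x => (g x + 1) / 2) (by fun_prop)
    (fun x => by have := (abs_le.1 (h1 x)).1; linarith)
    (fun x => by have := (abs_le.1 (h1 x)).2; linarith)
  have hgi : ∀ (ρ : Measure α) [IsProbabilityMeasure ρ], Integrable g ρ := fun ρ _ =>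
    Integrable.of_bound hg.aestronglyMeasurable 1
      (ae_of_all _ fun x => by rw [Real.norm_eq_abs]; exact h1 x)
  have e : ∀ (ρ : Measure α) [IsProbabilityMeasure ρ],
      ∫ x, (g x + 1) / 2 ∂ρ = (∫ x, g x ∂ρ + 1) / 2 := by
    intro ρ _
    rw [integral_div, integral_add (hgi ρ) (integrable_const _), integral_const, smul_eq_mul,
      mul_one, probReal_univ]
  rw [e μ, e ν, show (∫ x, g x ∂μ + 1) / 2 - (∫ x, g x ∂ν + 1) / 2 =
    (∫ x, g x ∂μ - ∫ x, g x ∂ν) / 2 by ring, abs_div, abs_of_pos (two_pos : (0 : ℝ) < 2),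
    div_le_iff₀ (two_pos : (0 : ℝ) < 2)] at key
  linarith

namespace Literature.Probability.Distributions

open Literature.MeasureTheory.TotalVariation

variable {E₁ : Type*} [NormedAddCommGroup E₁] [InnerProductSpace ℝ E₁] [FiniteDimensional ℝ E₁]
  [MeasurableSpace E₁] [BorelSpace E₁]
variable {F : Type*} [NormedAddCommGroup F] [InnerProductSpace ℝ F] [FiniteDimensional ℝ F]
  [MeasurableSpace F] [BorelSpace F]

omit [FiniteDimensional ℝ E₁] [MeasurableSpace E₁] [BorelSpace E₁] [InnerProductSpace ℝ F]
  [FiniteDimensional ℝ F] [MeasurableSpace F] [BorelSpace F] in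
/-- `x = √(‖x‖² + ‖y‖²) · b(x, y)` identically (also at the origin, where both sides vanish).
[folklore] -/
theorem sqrt_normSq_smul_sphereMarginalMap (p : E₁ × F) :
    Real.sqrt (‖p.1‖ ^ 2 + ‖p.2‖ ^ 2) • sphereMarginalMap E₁ F p = p.1 := by
  unfold sphereMarginalMap
  by_cases h0 : Real.sqrt (‖p.1‖ ^ 2 + ‖p.2‖ ^ 2) = 0
  · have h1 : ‖p.1‖ ^ 2 + ‖p.2‖ ^ 2 ≤ 0 := Real.sqrt_eq_zero'.1 h0
    have h2 : ‖p.1‖ = 0 := by nlinarith [norm_nonneg p.1, norm_nonneg p.2]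
    rw [norm_eq_zero.1 h2, smul_zero, smul_zero]
  · rw [smul_smul, mul_inv_cancel₀ h0, one_smul]

/-- **Maxwell–Borel lemma in testing form, with the Diaconis–Freedman rate.** For independent
standard Gaussian vectors `x ∈ E₁`, `z ∈ F` (`k = dim E₁`, `dim F ≥ 3`, `d = k + dim F`),
`Q = ‖x‖² + ‖z‖²`, every measurable `g : E₁ → [-1, 1]` and every bounded measurable `ψ ≥ 0`:
`|E[(g(x) − ∫ g(√(Q/d)·u) dγ_{E₁}(u)) ψ(Q)]| ≤ 2(k(k+2) + 32·2ᵏ)/d · E[ψ(Q)]` — the conditional law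
of `x` given the squared radius is within `O(1/d)` of `N(0, (Q/d) I)` uniformly in `Q`.
[cite: DiaconisFreedman1987, Thm 1] -/
theorem abs_integral_sub_gaussianAverage_mul_le (hF : 3 ≤ finrank ℝ F) {g : E₁ → ℝ}
    (hg : Measurable g) (hg1 : ∀ v, |g v| ≤ 1) {ψ : ℝ → ℝ} (hψ : Measurable ψ)
    (hψ0 : ∀ q, 0 ≤ ψ q) {C : ℝ} (hψC : ∀ q, ψ q ≤ C) :
    |∫ p, (g p.1 - ∫ u, g (Real.sqrt ((‖p.1‖ ^ 2 + ‖p.2‖ ^ 2) / ↑(finrank ℝ E₁ + finrank ℝ F)) • u)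
        ∂(stdGaussian E₁)) * ψ (‖p.1‖ ^ 2 + ‖p.2‖ ^ 2) ∂((stdGaussian E₁).prod (stdGaussian F))| ≤
      2 * (((finrank ℝ E₁ : ℝ) * (finrank ℝ E₁ + 2) + 32 * 2 ^ finrank ℝ E₁) /
          ↑(finrank ℝ E₁ + finrank ℝ F)) *
        ∫ p, ψ (‖p.1‖ ^ 2 + ‖p.2‖ ^ 2) ∂((stdGaussian E₁).prod (stdGaussian F)) := by
  haveI : Nontrivial F := Module.nontrivial_of_finrank_pos (R := ℝ) (by omega)
  have hd0 : (0 : ℝ) < ↑(finrank ℝ E₁ + finrank ℝ F) := by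
    exact_mod_cast (by omega : 0 < finrank ℝ E₁ + finrank ℝ F)
  have htv := tvClose_sphereMarginal_stdGaussian (E₁ := E₁) (F := F) hF
  have hprod := map_sphereMarginalMap_normSq_eq_prod (E₁ := E₁) (F := F)
  set d : ℝ := ((finrank ℝ E₁ + finrank ℝ F : ℕ) : ℝ) with hd
  set δ : ℝ := ((finrank ℝ E₁ : ℝ) * (finrank ℝ E₁ + 2) + 32 * 2 ^ finrank ℝ E₁) / d with hδ
  clear_value d δ
  have hδ0 : 0 ≤ δ := htv.nonneg
  have hC0 : 0 ≤ C := (hψ0 0).trans (hψC 0)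
  -- notation
  set μ : Measure (E₁ × F) := (stdGaussian E₁).prod (stdGaussian F) with hμ
  have hb : Measurable (sphereMarginalMap E₁ F) := measurable_sphereMarginalMap
  have hQ : Measurable fun p : E₁ × F => ‖p.1‖ ^ 2 + ‖p.2‖ ^ 2 := by fun_prop
  have hT : Measurable fun p : E₁ × F => (sphereMarginalMap E₁ F p, ‖p.1‖ ^ 2 + ‖p.2‖ ^ 2) :=
    hb.prodMk hQ
  set D : Measure E₁ := μ.map (sphereMarginalMap E₁ F) with hD
  set ρ : Measure ℝ := μ.map (fun p : E₁ × F => ‖p.1‖ ^ 2 + ‖p.2‖ ^ 2) with hρ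
  haveI : IsProbabilityMeasure D := Measure.isProbabilityMeasure_map hb.aemeasurable
  haveI : IsProbabilityMeasure ρ := Measure.isProbabilityMeasure_map hQ.aemeasurable
  haveI : IsProbabilityMeasure (D.map fun b : E₁ => Real.sqrt d • b) :=
    Measure.isProbabilityMeasure_map (measurable_const_smul _).aemeasurable
  -- the Gaussian average `m(q) = ∫ g(√(q/d) u) dγ(u)` and the reduced integrand `G(b, q)`
  set m : ℝ → ℝ := fun q => ∫ u, g (Real.sqrt (q / d) • u) ∂(stdGaussian E₁) with hm
  have hgsm : Measurable fun qu : ℝ × E₁ => g (Real.sqrt (qu.1 / d) • qu.2) := hg.comp (by fun_prop)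
  have hm_meas : Measurable m :=
    (hgsm.stronglyMeasurable.integral_prod_right' (ν := stdGaussian E₁)).measurable
  have hm1 : ∀ q, |m q| ≤ 1 := fun q => by
    have := norm_integral_le_of_norm_le_const (μ := stdGaussian E₁)
      (f := fun u => g (Real.sqrt (q / d) • u)) (C := 1) (ae_of_all _ fun u => by
        rw [Real.norm_eq_abs]; exact hg1 _)
    rwa [probReal_univ, mul_one, Real.norm_eq_abs] at this
  set G : E₁ × ℝ → ℝ := fun bq => (g (Real.sqrt bq.2 • bq.1) - m bq.2) * ψ bq.2 with hG
  have hG_meas : Measurable G :=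
    ((hg.comp (by fun_prop)).sub (hm_meas.comp measurable_snd)).mul (hψ.comp measurable_snd)
  have hG_bdd : ∀ bq, ‖G bq‖ ≤ 2 * C := fun bq => by
    rw [Real.norm_eq_abs, hG]
    dsimp only
    rw [abs_mul, abs_of_nonneg (hψ0 _)]
    have h1 : |g (Real.sqrt bq.2 • bq.1) - m bq.2| ≤ 2 := by
      have := hg1 (Real.sqrt bq.2 • bq.1)
      have := hm1 bq.2
      rw [abs_le] at *
      constructor <;> linarith
    exact mul_le_mul h1 (hψC _) (hψ0 _) (by norm_num)
  -- Step 1: the integrand is `G (b p, Q p)`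
  have hint : ∀ p : E₁ × F,
      (g p.1 - m (‖p.1‖ ^ 2 + ‖p.2‖ ^ 2)) * ψ (‖p.1‖ ^ 2 + ‖p.2‖ ^ 2) =
        G (sphereMarginalMap E₁ F p, ‖p.1‖ ^ 2 + ‖p.2‖ ^ 2) := fun p => by
    rw [hG]
    dsimp only
    rw [sqrt_normSq_smul_sphereMarginalMap p]
  -- Step 2: change of variables to the product law and Fubini
  have hGi : Integrable G (D.prod ρ) :=
    (integrable_const (2 * C)).mono' hG_meas.aestronglyMeasurable (ae_of_all _ hG_bdd)
  have h2 : ∫ p, G (sphereMarginalMap E₁ F p, ‖p.1‖ ^ 2 + ‖p.2‖ ^ 2) ∂μ =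
      ∫ q, ∫ b, G (b, q) ∂D ∂ρ := by
    rw [← integral_map hT.aemeasurable hG_meas.aestronglyMeasurable, hprod, integral_prod_symm G hGi]
  -- Step 3: the inner integral at fixed `q`
  have hgq : ∀ q : ℝ, Integrable (fun b : E₁ => g (Real.sqrt q • b)) D := fun q =>
    Integrable.of_bound (hg.comp (measurable_const_smul _)).aestronglyMeasurable 1
      (ae_of_all _ fun b => by rw [Real.norm_eq_abs]; exact hg1 _)
  have h3 : ∀ q : ℝ, ∫ b, G (b, q) ∂D = (∫ b, g (Real.sqrt q • b) ∂D - m q) * ψ q := fun q => by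
    rw [hG]
    dsimp only
    rw [integral_mul_const, integral_sub (hgq q) (integrable_const _), integral_const, smul_eq_mul,
      probReal_univ, one_mul]
  have h4 : ∀ q : ℝ, |∫ b, g (Real.sqrt q • b) ∂D - m q| ≤ 2 * δ := fun q => by
    have hsq : ∀ b : E₁, Real.sqrt (q / d) • (Real.sqrt d • b) = Real.sqrt q • b := fun b => by
      rw [smul_smul, ← Real.sqrt_mul' _ hd0.le, div_mul_cancel₀ q hd0.ne']
    have e1 : ∫ b, g (Real.sqrt q • b) ∂D =
        ∫ y, g (Real.sqrt (q / d) • y) ∂(D.map fun b : E₁ => Real.sqrt d • b) := by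
      have hf : AEStronglyMeasurable (fun y : E₁ => g (Real.sqrt (q / d) • y))
          (D.map fun b : E₁ => Real.sqrt d • b) :=
        (hg.comp (measurable_const_smul _)).aestronglyMeasurable
      rw [integral_map (measurable_const_smul _).aemeasurable hf]
      simp_rw [hsq]
    rw [e1]
    exact htv.abs_integral_sub_le_two_mul (hg.comp (measurable_const_smul _)) fun y => hg1 _
  -- Step 4: integrate the bound
  have h5 : |∫ q, ∫ b, G (b, q) ∂D ∂ρ| ≤ 2 * δ * ∫ q, ψ q ∂ρ := by
    have hψi : Integrable ψ ρ := Integrable.of_bound hψ.aestronglyMeasurable C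
      (ae_of_all _ fun q => by rw [Real.norm_eq_abs, abs_of_nonneg (hψ0 q)]; exact hψC q)
    calc |∫ q, ∫ b, G (b, q) ∂D ∂ρ| ≤ ∫ q, |∫ b, G (b, q) ∂D| ∂ρ := abs_integral_le_integral_abs
      _ ≤ ∫ q, 2 * δ * ψ q ∂ρ := by
          refine integral_mono_of_nonneg (ae_of_all _ fun q => abs_nonneg _) (hψi.const_mul _)
            (ae_of_all _ fun q => ?_)
          dsimp only
          rw [h3 q, abs_mul, abs_of_nonneg (hψ0 q)]
          exact mul_le_mul_of_nonneg_right (h4 q) (hψ0 q)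
      _ = 2 * δ * ∫ q, ψ q ∂ρ := integral_const_mul _ _
  have h6 : ∫ q, ψ q ∂ρ = ∫ p, ψ (‖p.1‖ ^ 2 + ‖p.2‖ ^ 2) ∂μ :=
    integral_map hQ.aemeasurable hψ.aestronglyMeasurable
  show |∫ p, (g p.1 - m (‖p.1‖ ^ 2 + ‖p.2‖ ^ 2)) * ψ (‖p.1‖ ^ 2 + ‖p.2‖ ^ 2) ∂μ| ≤
    2 * δ * ∫ p, ψ (‖p.1‖ ^ 2 + ‖p.2‖ ^ 2) ∂μ
  simp_rw [hint]
  rw [h2, ← h6]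
  exact h5

end Literature.Probability.Distributions

end
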